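import Literature.Geometry.Lorentzian.BondiBartnikGap
import Literature.Geometry.Lorentzian.NearKerrCollarCore
import Literature.Geometry.Lorentzian.SoundNearKerrLeaf
import Literature.Geometry.Lorentzian.KillingHorizonShadowAlong
import Literature.Geometry.Lorentzian.CausalFutureProofs
import Literature.Geometry.Lorentzian.CausalityClosedProofs
import Literature.Geometry.Lorentzian.DeviationTolerance
import Literature.Geometry.Lorentzian.KerrDataProofs
import Literature.Geometry.Lorentzian.KerrSchildCoord
import Summits.FinalStateConjecture.FinalStateConjecture.Theorems.BartnikGapSettlingBondiBartnikRigidityDirectMethodDefs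
import HarnessLib

/-!
# Route signatures for K2 (`stub_stationaryKerrCollarExtension`) — scratch, NOT for landing

The named facts of the honest proof route of K2, typed in the tree's vocabulary (see the report
`stub_stationaryKerrCollarExtension.report.md`).  Every `def … : Prop` here is a STATEMENT only.
-/

noncomputable section

set_option linter.dupNamespace false
set_option maxSynthPendingDepth 3

open Set Filter Function Topology TopologicalSpace
open Literature.Geometry.Lorentzian
open scoped Manifold ContDiff Topology ENNReal

namespace Summit.FinalStateConjecture.FinalStateConjecture.Theorems.BondiBartnikRigidity.DirectMethod

universe u

/-- `D⁺(W) ⊆ J⁺(W)`: through every point passes a past-endless timelike curve. -/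
theorem futureDomain_subset_causalFuture (𝒮 : Spacetime.{u} 4) (W : Set 𝒮.carrier) :
    futureDomain 𝒮 W ⊆ 𝒮.metric.causalFuture 𝒮.timeOrientation W := by
  intro q hq
  have hn2 : (2 : ℕ∞ω) ≤ ((⊤ : ℕ∞) : ℕ∞ω) := WithTop.coe_le_coe.mpr le_top
  obtain ⟨Δ, Dm, hΔ, h0, hΔ0⟩ :=
    LorentzianMetric.exists_isEndlessTimelikeCurve_through (g := 𝒮.metric) (τ := 𝒮.timeOrientation)
      hn2 q
  obtain ⟨t, ht, ht0, hW⟩ := hq Δ Dm hΔ.1 hΔ.2.1.isFutureCausalCurveOn hΔ.2.2.2 0 h0 hΔ0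
  rcases ht0.eq_or_lt with rfl | hlt
  · exact LorentzianMetric.subset_causalFuture _ _ _ (hΔ0 ▸ hW)
  · refine Or.inr ⟨Δ t, hW, Δ, t, 0, hlt, ?_, rfl, hΔ0⟩
    exact hΔ.2.1.isFutureCausalCurveOn.mono (hΔ.1.out ht h0)

/-- `J⁺(D⁺(W)) ⊆ J⁺(W)`… more precisely `D⁺(W) ⊆ J⁺(W')` whenever `W ⊆ J⁺(W')`. -/
theorem futureDomain_subset_causalFuture_of_subset (𝒮 : Spacetime.{u} 4) {W W' : Set 𝒮.carrier}
    (h : W ⊆ 𝒮.metric.causalFuture 𝒮.timeOrientation W') :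
    futureDomain 𝒮 W ⊆ 𝒮.metric.causalFuture 𝒮.timeOrientation W' := by
  have hn2 : (2 : ℕ∞ω) ≤ ((⊤ : ℕ∞) : ℕ∞ω) := WithTop.coe_le_coe.mpr le_top
  refine (futureDomain_subset_causalFuture 𝒮 W).trans ?_
  refine (LorentzianMetric.causalFuture_mono h).trans ?_
  rw [LorentzianMetric.causalFuture_causalFuture_eq hn2]

variable {X : Type u} [TopologicalSpace X] [ChartedSpace E3 X] [IsManifold (𝓡 3) ∞ X]
  [ConnectedSpace X] {D : InitialDataSet (𝓡 3) X}

/-- The shell image lies in the core. -/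
theorem image_shellSlab_subset_collarCore (𝒱 : VacuumCauchyDevelopment D) (M : Fin 1 → ℝ)
    (p : 𝒱.carrier) (B : Fin 1 → ModelBackground) (Φ : ∀ i, (B i).domain → 𝒱.carrier) :
    Φ 0 '' shellSlab (B 0) (M 0) ⊆ collarCore M p B Φ :=
  (image_mono (shellSlab_subset_truncTimeSlab (B 0) (M 0))).trans
    (image_truncTimeSlab_subset_collarCore M p B Φ 0)

/-- `C ∪ N_out ⊆ J⁺(C)`. -/
theorem collarCore_union_roof_subset_causalFuture (𝒱 : VacuumCauchyDevelopment D)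
    (M : Fin 1 → ℝ) (p : 𝒱.carrier) (B : Fin 1 → ModelBackground)
    (Φ : ∀ i, (B i).domain → 𝒱.carrier) :
    collarCore M p B Φ ∪
        (frontier (𝒱.metric.causalFuture 𝒱.timeOrientation (collarCore M p B Φ)) ∩
          𝒱.metric.causalFuture 𝒱.timeOrientation (Φ 0 '' shellSlab (B 0) (M 0))) ⊆
      𝒱.metric.causalFuture 𝒱.timeOrientation (collarCore M p B Φ) :=
  union_subset (LorentzianMetric.subset_causalFuture _ _ _)
    (inter_subset_right.trans
      (LorentzianMetric.causalFuture_mono (image_shellSlab_subset_collarCore 𝒱 M p B Φ)))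

/-- **`killingDomain ⊆ J⁺(C)`**: `D⁺(C ∪ N_out) ⊆ J⁺(C ∪ N_out) ⊆ J⁺(J⁺(C)) = J⁺(C)`. -/
theorem killingDomain_subset_causalFuture (𝒱 : VacuumCauchyDevelopment D) (M : Fin 1 → ℝ)
    (p : 𝒱.carrier) (B : Fin 1 → ModelBackground) (Φ : ∀ i, (B i).domain → 𝒱.carrier) :
    killingDomain 𝒱 M p B Φ ⊆ 𝒱.metric.causalFuture 𝒱.timeOrientation (collarCore M p B Φ) :=
  futureDomain_subset_causalFuture_of_subset 𝒱.toSpacetime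
    (collarCore_union_roof_subset_causalFuture 𝒱 M p B Φ)

/-- A box inside `interior (killingDomain …)` is a box inside `J⁺(C)`. -/
theorem IsNearModelBox.of_interior_killingDomain {𝒱 : VacuumCauchyDevelopment D}
    {M : Fin 1 → ℝ} {p : 𝒱.carrier} {B : Fin 1 → ModelBackground}
    {Φ : ∀ i, (B i).domain → 𝒱.carrier} {B' : ModelBackground} {k : ℕ} {ε : ℝ≥0∞}
    {τ₁ τ₂ r₁ r₂ : ℝ} {Ψ : B'.domain → 𝒱.carrier}
    (h : IsNearModelBox 𝒱.toSpacetime B' k ε τ₁ τ₂ r₁ r₂ (interior (killingDomain 𝒱 M p B Φ)) Ψ) :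
    IsNearModelBox 𝒱.toSpacetime B' k ε τ₁ τ₂ r₁ r₂
      (𝒱.metric.causalFuture 𝒱.timeOrientation (collarCore M p B Φ)) Ψ :=
  h.mono_set (interior_subset.trans (killingDomain_subset_causalFuture 𝒱 M p B Φ))

section Boxes

variable {𝒮 : Spacetime.{u} 4} {B : ModelBackground} {k : ℕ} {ε : ℝ≥0∞} {τ₁ τ₂ r₁ r₂ : ℝ}
  {J : Set 𝒮.carrier} {Ψ : B.domain → 𝒮.carrier}

/-- A coordinate box with `τ₂ ≤ τ₁` or `r₂ ≤ r₁` is empty. -/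
theorem coordBox_eq_empty_of_le (B : ModelBackground) {τ₁ τ₂ r₁ r₂ : ℝ} (h : τ₂ ≤ τ₁ ∨ r₂ ≤ r₁) :
    coordBox B τ₁ τ₂ r₁ r₂ = ∅ := by
  ext x
  simp only [mem_coordBox, mem_empty_iff_false, iff_false, not_and, not_lt]
  intro h₁ h₂ h₃
  rcases h with h | h
  · exact absurd (h₁.trans h₂) (not_lt.2 h)
  · exact h.trans h₃.le

/-- `supCkENorm` over the empty set vanishes. -/
theorem supCkENorm_empty {F G : Type*} [NormedAddCommGroup F] [NormedSpace ℝ F]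
    [NormedAddCommGroup G] [NormedSpace ℝ G] (k : ℕ) (f : F → G) : supCkENorm ∅ k f = 0 := by
  simp [supCkENorm]

/-- An EMPTY box is an `(ε, k)`-box for every chart (all four clauses are vacuous). -/
theorem isNearModelBox_of_coordBox_eq_empty (h : coordBox B τ₁ τ₂ r₁ r₂ = ∅)
    (Ψ : B.domain → 𝒮.carrier) : IsNearModelBox 𝒮 B k ε τ₁ τ₂ r₁ r₂ J Ψ := by
  refine ⟨by rw [h]; exact contMDiffOn_empty, ?_, by rw [h, image_empty]; exact empty_subset _, ?_⟩
  · haveI : IsEmpty (coordBox B τ₁ τ₂ r₁ r₂) := by rw [h]; infer_instance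
    exact .of_continuous_injective_isOpenMap continuous_of_discreteTopology
      (fun a ↦ isEmptyElim a) (fun s _ ↦ by rw [Set.eq_empty_of_isEmpty s, image_empty]; exact isOpen_empty)
  · rw [h, image_empty, supCkENorm_empty]
    exact zero_le

/-- DEGENERATE INSTANCES of the stub's conclusion: for `T ≤ 0` or `R + 1 ≤ M₀` the box
`{τ < t < τ + T, M₀ < r < R + 1}` is empty and any chart will do. -/
theorem exists_isNearModelBox_of_degenerate (𝒮 : Spacetime.{u} 4) (B : ModelBackground) (k : ℕ)
    (J : Set 𝒮.carrier) {M₀ R T : ℝ} (h : T ≤ 0 ∨ R + 1 ≤ M₀) (Ψ : B.domain → 𝒮.carrier) :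
    ∃ (τ : ℝ) (Ψ : B.domain → 𝒮.carrier), IsNearModelBox 𝒮 B k 0 τ (τ + T) M₀ (R + 1) J Ψ :=
  ⟨0, Ψ, isNearModelBox_of_coordBox_eq_empty
    (coordBox_eq_empty_of_le B (h.imp (fun hT ↦ by linarith) id)) Ψ⟩

/-- **Exactness at order `0` on an OPEN box is exactness at every order**: if the box is open in
`E4` (e.g. for a background with continuous time and radius functions) and the deviation vanishes
on it, all its iterated derivatives vanish there (they are local). So the regularity index `k` of an
EXACT (`ε = 0`) box is idle. -/
theorem IsNearModelBox.of_exact_order_zero (hopen : IsOpen (Subtype.val '' coordBox B τ₁ τ₂ r₁ r₂))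
    (h : IsNearModelBox 𝒮 B 0 0 τ₁ τ₂ r₁ r₂ J Ψ) (k : ℕ) : IsNearModelBox 𝒮 B k 0 τ₁ τ₂ r₁ r₂ J Ψ := by
  refine ⟨h.1, h.2.1, h.2.2.1, ?_⟩
  set S := Subtype.val '' coordBox B τ₁ τ₂ r₁ r₂ with hS
  set f := 𝒮.deviationExtend B Ψ with hf
  -- order `0`: `f` vanishes on `S`
  have h0 : ∀ x ∈ S, f x = 0 := by
    intro x hx
    have hle := (enorm_iteratedFDeriv_le_supCkENorm (k := 0) le_rfl hx f).trans h.2.2.2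
    have h' : iteratedFDeriv ℝ 0 f x = 0 := by
      have := le_antisymm hle zero_le
      rwa [enorm_eq_zero] at this
    calc f x = iteratedFDeriv ℝ 0 f x Fin.elim0 := (iteratedFDeriv_zero_apply _).symm
      _ = 0 := by rw [h']; rfl
  -- locality: on the open set `S`, `f` agrees with `0` near every point
  refine iSup₂_le fun m _ ↦ iSup₂_le fun x hx ↦ ?_
  have hfx : f =ᶠ[𝓝 x] (0 : E4 → E4 →L[ℝ] E4 →L[ℝ] ℝ) :=
    Filter.eventuallyEq_of_mem (hopen.mem_nhds hx) fun y hy ↦ h0 y hy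
  have := (hfx.iteratedFDeriv ℝ m).eq_of_nhds
  rw [this, iteratedFDeriv_zero, Pi.zero_apply, enorm_zero]

end Boxes

/-! ### Openness of coordinate boxes of backgrounds with continuous time and radius -/

section OpenBoxes

variable {𝒮 : Spacetime.{u} 4} {B : ModelBackground} {τ₁ τ₂ r₁ r₂ : ℝ}

/-- A coordinate box of a background with continuous time and radius functions is open in the
domain. -/
theorem isOpen_coordBox (ht : Continuous B.time) (hr : Continuous B.radius) (τ₁ τ₂ r₁ r₂ : ℝ) :
    IsOpen (coordBox B τ₁ τ₂ r₁ r₂) := by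
  have h1 : IsOpen ((fun x : B.domain ↦ B.time x.1) ⁻¹' Ioo τ₁ τ₂) :=
    isOpen_Ioo.preimage (ht.comp continuous_subtype_val)
  have h2 : IsOpen ((fun x : B.domain ↦ B.radius x.1) ⁻¹' Ioo r₁ r₂) :=
    isOpen_Ioo.preimage (hr.comp continuous_subtype_val)
  convert h1.inter h2 using 1
  ext x
  simp only [mem_coordBox, mem_inter_iff, mem_preimage, mem_Ioo]
  tauto

/-- … and its image in `E4` is open. -/
theorem isOpen_image_val_coordBox (ht : Continuous B.time) (hr : Continuous B.radius)
    (τ₁ τ₂ r₁ r₂ : ℝ) : IsOpen (Subtype.val '' coordBox B τ₁ τ₂ r₁ r₂) :=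
  B.domain.isOpen.isOpenMap_subtype_val _ (isOpen_coordBox ht hr τ₁ τ₂ r₁ r₂)

/-- The time function of the boosted Kerr star background is continuous. -/
theorem continuous_time_starBackground (Λ : lorentzGroup) (c : E4) (M a : ℝ) (r : E4 → ℝ) :
    Continuous (starBackground Λ c M a r).time :=
  (PiLp.continuous_apply 2 _ 0).comp (continuous_poincareInv Λ c)

/-- The boosted Kerr–Schild radius is continuous. -/
theorem continuous_radius_starBackground (Λ : lorentzGroup) (c : E4) (M a : ℝ) :
    Continuous (starBackground Λ c M a (fun x => Kerr.radius a (poincareInv Λ c x))).radius :=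
  (Kerr.continuous_radius a).comp (continuous_poincareInv Λ c)

/-- Boxes of the collar background `B = starBackground Λ c M a (r_a ∘ (Λ, c)⁻¹)` are open in `E4`;
hence (`IsNearModelBox.of_exact_order_zero`) the regularity index of an EXACT box of a collar
background is idle. -/
theorem isOpen_image_val_coordBox_of_eq_starBackground {Λ : lorentzGroup} {c : E4} {M a : ℝ}
    (hB : B = starBackground Λ c M a (fun x => Kerr.radius a (poincareInv Λ c x)))
    (τ₁ τ₂ r₁ r₂ : ℝ) : IsOpen (Subtype.val '' coordBox B τ₁ τ₂ r₁ r₂) := by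
  subst hB
  exact isOpen_image_val_coordBox (continuous_time_starBackground Λ c M a _)
    (continuous_radius_starBackground Λ c M a) τ₁ τ₂ r₁ r₂

/-- **Restriction of an exact chart to a box.**  If `Ψ` is smooth on a set `Q ⊇ box`, an open
embedding of `Q`, maps `Q` into `J` and has vanishing deviation on `Q`, and the box is open (in the
domain and in `E4`), then `Ψ` is an exact `(0, k)`-box for every `k`. -/
theorem isNearModelBox_of_exactOn {Q : Set B.domain} {J : Set 𝒮.carrier} {Ψ : B.domain → 𝒮.carrier}
    (hs : ContMDiffOn 𝓘(ℝ, E4) (𝓡 4) ∞ Ψ Q) (he : IsOpenEmbedding (Q.restrict Ψ))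
    (hJ : Ψ '' Q ⊆ J) (hd : supCkENorm (Subtype.val '' Q) 0 (𝒮.deviationExtend B Ψ) ≤ 0)
    (hsub : coordBox B τ₁ τ₂ r₁ r₂ ⊆ Q) (hopen : IsOpen (coordBox B τ₁ τ₂ r₁ r₂))
    (hopenE : IsOpen (Subtype.val '' coordBox B τ₁ τ₂ r₁ r₂)) (k : ℕ) :
    IsNearModelBox 𝒮 B k 0 τ₁ τ₂ r₁ r₂ J Ψ := by
  refine IsNearModelBox.of_exact_order_zero hopenE ⟨hs.mono hsub, ?_, (image_mono hsub).trans hJ,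
    (supCkENorm_mono (image_mono hsub) 0 _).trans hd⟩ k
  have hincl : IsOpenEmbedding (Set.inclusion hsub) :=
    .inclusion hsub (continuous_subtype_val.isOpen_preimage _ hopen)
  exact he.comp hincl

end OpenBoxes

/-! ### The Kerr side: causal sets of the (unboosted) Kerr star chart `Kerr.spacetime M a M` -/

section KerrSide

variable [Kerr.Facts]

/-- `J⁺` of the bundled Kerr star spacetime `({r > M}, g_{M,a}, −g♯dt*)` (`Kerr.spacetime M a M`,
which needs `0 ≤ M` and the named-fact class `[Kerr.Facts]`). -/
def JK (M a : ℝ) (hM : 0 < M) (S : Set (Kerr.region a M)) : Set (Kerr.region a M) :=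
  (Kerr.spacetime M a M hM.le).metric.causalFuture (Kerr.spacetime M a M hM.le).timeOrientation S

/-- The Kerr-side thick slab `{t* = 0, M < r ≤ 3M}`. -/
def slabK (M a : ℝ) : Set (Kerr.region a M) := {y | y.1 0 = 0 ∧ Kerr.radius a y.1 ≤ 3 * M}

/-- The Kerr-side outer edge sphere `S₃ = {t* = 0, r = 3M}`. -/
def outerSphereK (M a : ℝ) : Set (Kerr.region a M) := {y | y.1 0 = 0 ∧ Kerr.radius a y.1 = 3 * M}

/-- The Kerr-side OUTER ROOF `C⁺(S₃) = ∂J⁺(slab) ∩ J⁺(S₃)` (in exact Kerr the advanced time `v` is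
non-decreasing along future causal curves, so no point of the inner sheet `{v = M}` lies in
`J⁺(S₃) ⊆ {v ≥ 3M}` and this IS the cone ruled from `S₃`). -/
def roofK (M a : ℝ) (hM : 0 < M) : Set (Kerr.region a M) :=
  frontier (JK M a hM (slabK M a)) ∩ JK M a hM (outerSphereK M a)

/-- The truncated open causal future `J⁺(slab)° ∩ {t* < T₀, r < ρ}` of the Kerr slab. -/
def truncFutureK (M a : ℝ) (hM : 0 < M) (ρ T₀ : ℝ) : Set (Kerr.region a M) :=
  interior (JK M a hM (slabK M a)) ∩ {y | y.1 0 < T₀ ∧ Kerr.radius a y.1 < ρ}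

/-- A Kerr-side coordinate box `{τ₁ < t* < τ₂, r₁ < r < r₂}`. -/
def boxK (M a τ₁ τ₂ r₁ r₂ : ℝ) : Set (Kerr.region a M) :=
  {y | τ₁ < y.1 0 ∧ y.1 0 < τ₂ ∧ r₁ < Kerr.radius a y.1 ∧ Kerr.radius a y.1 < r₂}

omit [Kerr.Facts] in
/-- Pull-back of a Kerr-side set to the domain of a (boosted) background along the rest-frame map
`x ↦ Λ⁻¹(x − c)` (for the collar background `B = starBackground Λ c M a (r_a ∘ (Λ,c)⁻¹)` this map
IS the identification of `B.domain` with `Kerr.region a M`). -/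
def pullK (mo : lorentzGroup × E4) (M a : ℝ) (B : ModelBackground) (S : Set (Kerr.region a M)) :
    Set B.domain :=
  {x | ∃ h : poincareInv mo.1 mo.2 x.1 ∈ Kerr.region a M, (⟨poincareInv mo.1 mo.2 x.1, h⟩ : Kerr.region a M) ∈ S}

omit [Kerr.Facts] in
theorem pullK_mono (mo : lorentzGroup × E4) (M a : ℝ) (B : ModelBackground)
    {S T : Set (Kerr.region a M)} (h : S ⊆ T) : pullK mo M a B S ⊆ pullK mo M a B T :=
  fun _ ⟨hx, hS⟩ ↦ ⟨hx, h hS⟩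

omit [Kerr.Facts] in
/-- The coordinate box of the collar background is the pull-back of the Kerr-side box. -/
theorem coordBox_subset_pullK_boxK {mo : lorentzGroup × E4} {M a : ℝ} {B : ModelBackground}
    (hB : B = starBackground mo.1 mo.2 M a (fun x => Kerr.radius a (poincareInv mo.1 mo.2 x)))
    (τ₁ τ₂ r₁ r₂ : ℝ) : coordBox B τ₁ τ₂ r₁ r₂ ⊆ pullK mo M a B (boxK M a τ₁ τ₂ r₁ r₂) := by
  subst hB
  intro x hx
  exact ⟨x.2, hx⟩

/-- **ROOF CHART** — the hypothesis block shared by F4 (as conclusion) and F5 (as hypothesis): an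
exact chart `Ψ_N` of the collar background on the pull-back of a Kerr-side one-sided neighbourhood
`O ∩ J⁺(slab)°` of the roof portion `C⁺(S₃) ∩ {r ≤ ρ}`, continuous up to that roof portion, which it
maps onto the achronal boundary `∂J⁺(C)` of the development, matching the collar chart on `S₃`,
with image of the open part in `J`. -/
def IsRoofChart {𝒮 : Spacetime.{0} 4} (mo : lorentzGroup × E4) (M a : ℝ) (hM : 0 < M)
    (B : ModelBackground) (C J : Set 𝒮.carrier) (Φ₀ : B.domain → 𝒮.carrier) (ρ : ℝ)
    (O : Set (Kerr.region a M)) (Ψ : B.domain → 𝒮.carrier) : Prop :=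
  IsOpen O ∧ roofK M a hM ∩ {y | Kerr.radius a y.1 ≤ ρ} ⊆ O ∧
  ContMDiffOn 𝓘(ℝ, E4) (𝓡 4) ∞ Ψ (pullK mo M a B (O ∩ interior (JK M a hM (slabK M a)))) ∧
  IsOpenEmbedding ((pullK mo M a B (O ∩ interior (JK M a hM (slabK M a)))).restrict Ψ) ∧
  Ψ '' pullK mo M a B (O ∩ interior (JK M a hM (slabK M a))) ⊆ J ∧
  supCkENorm (Subtype.val '' pullK mo M a B (O ∩ interior (JK M a hM (slabK M a)))) 0
    (𝒮.deviationExtend B Ψ) ≤ 0 ∧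
  ContinuousOn Ψ (pullK mo M a B (O ∩ (interior (JK M a hM (slabK M a)) ∪ roofK M a hM))) ∧
  Ψ '' pullK mo M a B (O ∩ roofK M a hM) ⊆ frontier (𝒮.metric.causalFuture 𝒮.timeOrientation C) ∧
  ∀ x ∈ pullK mo M a B (outerSphereK M a), Ψ x = Φ₀ x

end KerrSide


namespace K2Route

/-! ### Regions of the star background named in Kerr-star coordinates -/

/-- The open FUTURE INNER DIAMOND `Δ = {0 < t*, t* + r < 3M}` of the thick slab
`{t* = 0, M < r ≤ 3M}` (within the star domain `{r > M}`): bounded by the slab and by the INGOING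
null hypersurface `N̲ = {v := t* + r = 3M}` through the outer edge sphere `S₃` (in ingoing
Kerr / Kerr-star coordinates `v = t_KS + r` is constant along the ingoing principal null
congruence, so `{v = const}` is null for every `a`).  On paper: `Δ = D⁺_Kerr(slab)° ∩ {r > M}`. -/
def slabDiamond (B : ModelBackground) (M : ℝ) : Set B.domain :=
  {x | 0 < B.time x.1 ∧ B.time x.1 + B.radius x.1 < 3 * M}

/-- The closed-below diamond `{0 ≤ t*, t* + r < 3M}` (the diamond together with the open slab). -/
def slabDiamondWithSlab (B : ModelBackground) (M : ℝ) : Set B.domain :=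
  {x | 0 ≤ B.time x.1 ∧ B.time x.1 + B.radius x.1 < 3 * M}

/-- The outer edge sphere `S₃ = {t* = 0, r = 3M}` of the thick slab. -/
def outerSphere (B : ModelBackground) (M : ℝ) : Set B.domain :=
  {x | B.time x.1 = 0 ∧ B.radius x.1 = 3 * M}

variable {X : Type} [TopologicalSpace X] [ChartedSpace E3 X] [IsManifold (𝓡 3) ∞ X]
  [ConnectedSpace X] {D : InitialDataSet (𝓡 3) X}

/-- The OUTER ROOF `N₊` of the core `C`: the points of the achronal boundary `∂J⁺(C)` joined to the
image of the outer edge sphere `Φ₀(S₃)` by a future causal curve LYING IN `∂J⁺(C)` — i.e. the part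
of `∂J⁺(C)` ruled by the null generators leaving `S₃` (robust against the inner sheet `N₋` from the
inner edge `{r = M}`, which no generator from `S₃` reaches). -/
def outerRoof (𝒱 : VacuumCauchyDevelopment D) (M : Fin 1 → ℝ) (p : 𝒱.carrier)
    (B : Fin 1 → ModelBackground) (Φ : ∀ i, (B i).domain → 𝒱.carrier) : Set 𝒱.carrier :=
  {y | ∃ x ∈ Φ 0 '' outerSphere (B 0) (M 0), ∃ (γ : ℝ → 𝒱.carrier) (a b : ℝ), a ≤ b ∧
    𝒱.metric.IsFutureCausalCurveOn 𝒱.timeOrientation γ (Icc a b) ∧ γ a = x ∧ γ b = y ∧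
    ∀ t ∈ Icc a b, γ t ∈ frontier (𝒱.metric.causalFuture 𝒱.timeOrientation (collarCore M p B Φ))}

/-! ### F1 — vacuum Cauchy rigidity of the exact thick slab (chart form) -/

/-- **F1 `SlabCauchyRigidity`** — an exact `k'`-jet (`k' ≥ 1`: induced metric AND second
fundamental form of the slab agree with Kerr's) of boosted Kerr on the thick slab of a collar chart
of a MAXIMAL vacuum Cauchy development, core on the Cauchy slice, gives an EXACT chart on the whole
future inner diamond `Δ = D⁺_Kerr(slab)° ∩ {r > M}`, continuous up to the slab where it agrees with
the collar chart, with image in the interior of the Killing domain (indeed in `D⁺(C)°`).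
Ingredients: local uniqueness for the vacuum Cauchy problem (Choquet-Bruhat–Geroch 1969, Thm. 3;
Ringström 2009, Thm. 16.6) + the localisation principle "the MGHD of a datum contains the MGHD of
every open sub-datum" (Hawking–Ellis 1973, §7.6, pp. 249–251; tree: `RelativeDevelopmentGluing*`,
`HypersurfaceDevelopmentGluing`) + the Kerr fact `D⁺_Kerr(slab) ⊇ Δ` (`t*` is a time function,
`r` increases to the past in `{r₋ < r < r₊}`, `v` is non-increasing to the past; DR 0811.0354 §5.1).
MISSING in the tree (its gluing inputs are landed).
[cite: HawkingEllis1973CUP, §7.6, pp. 249–251] [cite: Ringstrom2009, Thm. 16.6] -/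
def SlabCauchyRigidity : Prop :=
  ∀ (k' : ℕ), 1 ≤ k' →
    ∀ (X : Type) [TopologicalSpace X] [ChartedSpace E3 X] [IsManifold (𝓡 3) ∞ X]
      [T2Space X] [SecondCountableTopology X] [ConnectedSpace X]
      (D : InitialDataSet (𝓡 3) X) (𝒱 : VacuumCauchyDevelopment D)
      (M a : Fin 1 → ℝ) (p : 𝒱.carrier) (mo : Fin 1 → lorentzGroup × E4)
      (B : Fin 1 → ModelBackground) (Φ : ∀ i, (B i).domain → 𝒱.carrier),
    𝒱.IsMaximal → (∀ i, 0 < M i ∧ |a i| < M i) →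
    (∃ i, p ∈ Φ i '' (B i).truncTimeSlab (3 * M i) 0) →
    (∀ i, B i = starBackground (mo i).1 (mo i).2 (M i) (a i)
      (fun x => Kerr.radius (a i) (poincareInv (mo i).1 (mo i).2 x))) →
    (∀ i, ContMDiffOn 𝓘(ℝ, E4) (𝓡 4) ∞ (Φ i)
        {x | -1 < (B i).time x.1 ∧ (B i).time x.1 < 1 ∧ (B i).radius x.1 < 3 * M i + 1} ∧
      IsOpenEmbedding ({x | -1 < (B i).time x.1 ∧ (B i).time x.1 < 1 ∧
        (B i).radius x.1 < 3 * M i + 1}.restrict (Φ i))) →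
    (∀ i, 𝒱.toSpacetime.truncDeviationCk (B i) (Φ i) k' (3 * M i) 0 ≤ 0) →
    collarCore M p B Φ ⊆ range 𝒱.embed →
    ∃ Ψ : (B 0).domain → 𝒱.carrier,
      (∀ x ∈ (B 0).truncTimeSlab (3 * M 0) 0, Ψ x = Φ 0 x) ∧
      ContinuousOn Ψ (slabDiamondWithSlab (B 0) (M 0)) ∧
      ContMDiffOn 𝓘(ℝ, E4) (𝓡 4) ∞ Ψ (slabDiamond (B 0) (M 0)) ∧
      IsOpenEmbedding ((slabDiamond (B 0) (M 0)).restrict Ψ) ∧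
      Ψ '' slabDiamond (B 0) (M 0) ⊆ interior (killingDomain 𝒱 M p B Φ) ∧
      supCkENorm (Subtype.val '' slabDiamond (B 0) (M 0)) 0 (𝒱.toSpacetime.deviationExtend (B 0) Ψ) ≤ 0

/-! ### F2 — Müller zum Hagen analyticity, ported to `Spacetime 4` -/

/-- **F2 `MullerZumHagenSpacetime`** — a vacuum metric is real-analytic in suitable charts of the
maximal `C^∞` atlas near every point where a Killing field (Killing on an open set) is timelike.
The tree's named fact `mullerZumHagen1970_analytic_of_timelikeKilling` (`MullerZumHagenAnalyticity`,
decomposed in `MullerZumHagenStationaryHarmonicGauge`) is this statement over the carrier of a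
`StationaryAFBlackHole`; here over an arbitrary `Spacetime 4` (the proof is local and identical).
EXISTS in the tree in the wrong carrier — a PORT. [cite: MullerZumHagen1970, Theorem] -/
def MullerZumHagenSpacetime : Prop :=
  ∀ (𝒮 : Spacetime.{0} 4) [𝒮.metric.toPseudoRiemannianMetric.HasLeviCivita],
    𝒮.metric.toPseudoRiemannianMetric.IsRicciFlat →
    ∀ (U : Set 𝒮.carrier) (K : Π x : 𝒮.carrier, TangentSpace (𝓡 4) x), IsOpen U →
      𝒮.metric.IsKillingFieldOn K U →
      ∀ y ∈ U, 𝒮.metric.val y (K y) (K y) < 0 →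
        ∃ ψ ∈ IsManifold.maximalAtlas (𝓡 4) ((⊤ : ℕ∞) : WithTop ℕ∞) 𝒮.carrier,
          y ∈ ψ.source ∧ ∀ v w : E4,
            AnalyticOnNhd ℝ (fun q : E4 ↦ 𝒮.metric.val (ψ.symm q)
              (mfderiv 𝓘(ℝ, E4) (𝓡 4) ψ.symm q v) (mfderiv 𝓘(ℝ, E4) (𝓡 4) ψ.symm q w)) ψ.target

/-! ### F3 — Kerr rigidity on the timelike component (the elliptic step) -/

/-- **F3 `TimelikeKillingKerrContinuation`** — let `ξ` be Killing on an open set `U` of a vacuum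
Cauchy development and EXACTLY the push-forward `dΨ₀(Λ e₀)` of the boosted Kerr-star time
translation on an exact open Kerr box `Ψ₀(box) ⊆ U` of the star background `(Λ, c, M, a)`,
`|a| < M`, lying in the strictly stationary shell `r > 2M`.  Then EVERY point of the connected
component `V` of `{y ∈ U | g(ξ, ξ)(y) < 0}` containing the box is covered by an exact local chart
of the same background on which `ξ = dΨ(Λ e₀)`.  Proof on paper: `(V, g)` is real-analytic (F2);
isometries between analytic metrics are analytic and a local isometry into the analytic Kerr
chart continues along paths of an analytic chart ball (Kobayashi–Nomizu I, Ch. VI, Thm. 6.1 —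
developing map; the image cannot reach `r = 0` or `r = ∞` since `r − i a cos θ` is read off the
Weyl curvature, bounded on compact paths), so the locally-Kerr set is open-closed in `V`; the
continued correspondence keeps `ξ ↦ ∂_{t*}` (analytic Killing fields agreeing on an open set);
`ξ` timelike forces the image into the OUTER strictly stationary region `{r > r_E⁺(θ)} ⊆ {r > r₊}
⊆ {r > M}` (the inner one `{r < r_E⁻(θ)}` is separated from it for `|a| < M`, and `V` is
connected), i.e. into the star domain.  MISSING in the tree (F2 exists as a named fact to port;
Nomizu's extension `Nomizu1960_killing_extension` is vendored).
(Kobayashi–Nomizu I, Ch. VI, Thm. 6.1 — no bib key in references.bib) [cite: MullerZumHagen1970, Theorem] -/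
def TimelikeKillingKerrContinuation : Prop :=
  ∀ (X : Type) [TopologicalSpace X] [ChartedSpace E3 X] [IsManifold (𝓡 3) ∞ X]
    [T2Space X] [SecondCountableTopology X] [ConnectedSpace X]
    (D : InitialDataSet (𝓡 3) X) (𝒱 : VacuumCauchyDevelopment D)
    (M a : ℝ) (mo : lorentzGroup × E4) (B : ModelBackground) (U : Set 𝒱.carrier)
    (ξ : Π x : 𝒱.carrier, TangentSpace (𝓡 4) x) (τ₁ τ₂ r₁ r₂ : ℝ)
    (Ψ₀ : B.domain → 𝒱.carrier) (x₀ : B.domain),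
    0 < M → |a| < M →
    B = starBackground mo.1 mo.2 M a (fun x => Kerr.radius a (poincareInv mo.1 mo.2 x)) →
    IsOpen U →
    ∀ [𝒱.metric.toPseudoRiemannianMetric.HasLeviCivita],
    𝒱.metric.IsKillingFieldOn ξ U →
    2 * M ≤ r₁ → x₀ ∈ coordBox B τ₁ τ₂ r₁ r₂ →
    IsNearModelBox 𝒱.toSpacetime B 0 0 τ₁ τ₂ r₁ r₂ U Ψ₀ →
    (∀ x ∈ coordBox B τ₁ τ₂ r₁ r₂,
      ξ (Ψ₀ x) = mfderiv 𝓘(ℝ, E4) (𝓡 4) Ψ₀ x ((mo.1 : E4 ≃L[ℝ] E4) (E4.basisVector 0))) →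
    ∀ y ∈ connectedComponentIn {z | z ∈ U ∧ 𝒱.metric.val z (ξ z) (ξ z) < 0} (Ψ₀ x₀),
      ∃ (Q : Set B.domain) (Ψ : B.domain → 𝒱.carrier), IsOpen Q ∧ y ∈ Ψ '' Q ∧
        ContMDiffOn 𝓘(ℝ, E4) (𝓡 4) ∞ Ψ Q ∧ IsOpenEmbedding (Q.restrict Ψ) ∧ Ψ '' Q ⊆ U ∧
        supCkENorm (Subtype.val '' Q) 0 (𝒱.toSpacetime.deviationExtend B Ψ) ≤ 0 ∧
        ∀ x ∈ Q, ξ (Ψ x) = mfderiv 𝓘(ℝ, E4) (𝓡 4) Ψ x ((mo.1 : E4 ≃L[ℝ] E4) (E4.basisVector 0))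

/-! ### F4 — the outer roof stays in the timelike component (the load-bearing open step of K2) -/

/-- **F4 `OuterRoofStationarity`** — in the setting of K2 (exact thick collar, core on the slice,
`ξ` Killing on `U = interior killingDomain`, exact shell box on which `ξ = dΨ₀(Λ e₀)`), the timelike
component `V` of `ξ` through the box contains `U ∩ O` for some open `O ⊇ N₊` (`outerRoof`): the
Killing field cannot turn null along the outer roof.  Intended mechanism: on `V` the geometry is
locally Kerr with `ξ ↦ ∂_{t*}` (F3) and the Kerr radius `ρ` is defined; the roof generators develop
onto the outgoing null normals of Kerr's `S₃ = {t* = 0, r = 3M}`, which have `L = 0`,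
`Q = −a²E² cos²θ₀` and radial potential `R(r) = E²[(r² + a²)² − Δ a² sin²θ₀] > 0`, so `ṙ > 0`
throughout (Carter 1968; O'Neill 1995, Ch. 4): `ρ ≥ 3M > 2M ≥ r_E(θ)` along `N₊ ∩ closure V`,
whence `g(ξ, ξ) ≤ −1/3` there and `V` cannot end before the roof does.  OPEN: the one-sided
control (`ξ` lives on the open side `U` only, `S₃ ∉ U`) of `ξ` near `N₊` from the thin wedge
between `N̲` and `N₊` at `S₃` outward is the unproved part; an OUTER ergosurface crossing `J⁺(C)`
away from the roof is harmless for K2 (only the roof data are needed downstream, F5).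
[cite: Carter1968, §3] [cite: IonescuKlainerman2012, Thm. 1.1 and §1 (context: local Killing extension and its failure)] -/
def OuterRoofStationarity : Prop :=
  ∀ (k' : ℕ), 2 ≤ k' →
    ∀ (X : Type) [TopologicalSpace X] [ChartedSpace E3 X] [IsManifold (𝓡 3) ∞ X]
      [T2Space X] [SecondCountableTopology X] [ConnectedSpace X]
      (D : InitialDataSet (𝓡 3) X) (𝒱 : VacuumCauchyDevelopment D)
      (M a : Fin 1 → ℝ) (p : 𝒱.carrier) (mo : Fin 1 → lorentzGroup × E4)
      (B : Fin 1 → ModelBackground) (Φ : ∀ i, (B i).domain → 𝒱.carrier),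
    𝒱.IsMaximal → (∀ i, 0 < M i ∧ |a i| < M i) →
    (∃ i, p ∈ Φ i '' (B i).truncTimeSlab (3 * M i) 0) →
    (∀ i, B i = starBackground (mo i).1 (mo i).2 (M i) (a i)
      (fun x => Kerr.radius (a i) (poincareInv (mo i).1 (mo i).2 x))) →
    (∀ i, ContMDiffOn 𝓘(ℝ, E4) (𝓡 4) ∞ (Φ i)
        {x | -1 < (B i).time x.1 ∧ (B i).time x.1 < 1 ∧ (B i).radius x.1 < 3 * M i + 1} ∧
      IsOpenEmbedding ({x | -1 < (B i).time x.1 ∧ (B i).time x.1 < 1 ∧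
        (B i).radius x.1 < 3 * M i + 1}.restrict (Φ i))) →
    (∀ i, 𝒱.toSpacetime.truncDeviationCk (B i) (Φ i) k' (3 * M i) 0 ≤ 0) →
    collarCore M p B Φ ⊆ range 𝒱.embed →
    ∀ [𝒱.metric.toPseudoRiemannianMetric.HasLeviCivita],
    ∀ (ξ : Π x : 𝒱.carrier, TangentSpace (𝓡 4) x)
      (τ₁ r₁ r₂ : ℝ) (Ψ₀ : (B 0).domain → 𝒱.carrier) (x₀ : (B 0).domain),
    𝒱.metric.IsKillingFieldOn ξ (interior (killingDomain 𝒱 M p B Φ)) →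
    0 < τ₁ → 2 * M 0 ≤ r₁ → r₁ < r₂ → r₂ ≤ 3 * M 0 → x₀ ∈ coordBox (B 0) 0 τ₁ r₁ r₂ →
    IsNearModelBox 𝒱.toSpacetime (B 0) k' 0 0 τ₁ r₁ r₂ (interior (killingDomain 𝒱 M p B Φ)) Ψ₀ →
    (∀ x ∈ coordBox (B 0) 0 τ₁ r₁ r₂,
      ξ (Ψ₀ x) = mfderiv 𝓘(ℝ, E4) (𝓡 4) Ψ₀ x (((mo 0).1 : E4 ≃L[ℝ] E4) (E4.basisVector 0))) →
    ∃ O : Set 𝒱.carrier, IsOpen O ∧ outerRoof 𝒱 M p B Φ ⊆ O ∧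
      O ∩ interior (killingDomain 𝒱 M p B Φ) ⊆
        connectedComponentIn
          {z | z ∈ interior (killingDomain 𝒱 M p B Φ) ∧ 𝒱.metric.val z (ξ z) (ξ z) < 0} (Ψ₀ x₀)

/-! ### F4' — the outer roof is Kerr, charted (load-bearing open step of K2, chart form) -/

/-- **F4' `OuterRoofChart`** (K2's hypotheses ⟹ a roof chart for every radius `ρ`, with
`ξ = dΨ_N(Λ e₀)` on its open part and image in the interior of the Killing domain).  This is the
single fact of the route in which the Killing field enters; its paper ingredients are F2 (Müller
zum Hagen), F3 (continuation on the timelike component), the monotonicity `ṙ > 0` of the outgoing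
null normals of `S₃` in Kerr (no outer ergosurface ALONG THE ROOF), the coherence of the local
charts along the simply connected one-sided collar of `N₊ ≅ S² × ℝ` (developing map), and the reach
of `N₊` to every radius (`HasCutBondiMass`: sections of `∂J⁺(C)` of unbounded area lie on `N₊`,
since `N₋` focuses).  OPEN. [cite: MullerZumHagen1970, Theorem] [cite: Carter1968, §3]
(Kobayashi–Nomizu I, Ch. VI, Thm. 6.1 — no bib key in references.bib) -/
def OuterRoofChart : Prop :=
  ∀ [Kerr.Facts] (k' : ℕ), 2 ≤ k' →
    ∀ (X : Type) [TopologicalSpace X] [ChartedSpace E3 X] [IsManifold (𝓡 3) ∞ X]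
      [T2Space X] [SecondCountableTopology X] [ConnectedSpace X]
      (D : InitialDataSet (𝓡 3) X) (𝒱 : VacuumCauchyDevelopment D)
      (M a : Fin 1 → ℝ) (p : 𝒱.carrier) (mo : Fin 1 → lorentzGroup × E4)
      (B : Fin 1 → ModelBackground) (Φ : ∀ i, (B i).domain → 𝒱.carrier)
      (hmax : 𝒱.IsMaximal) (hpar : ∀ i, 0 < M i ∧ |a i| < M i),
    (∃ i, p ∈ Φ i '' (B i).truncTimeSlab (3 * M i) 0) →
    (∀ i, B i = starBackground (mo i).1 (mo i).2 (M i) (a i)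
      (fun x => Kerr.radius (a i) (poincareInv (mo i).1 (mo i).2 x))) →
    (∀ i, ContMDiffOn 𝓘(ℝ, E4) (𝓡 4) ∞ (Φ i)
        {x | -1 < (B i).time x.1 ∧ (B i).time x.1 < 1 ∧ (B i).radius x.1 < 3 * M i + 1} ∧
      IsOpenEmbedding ({x | -1 < (B i).time x.1 ∧ (B i).time x.1 < 1 ∧
        (B i).radius x.1 < 3 * M i + 1}.restrict (Φ i))) →
    (∀ i, 𝒱.toSpacetime.truncDeviationCk (B i) (Φ i) k' (3 * M i) 0 ≤ 0) →
    collarCore M p B Φ ⊆ range 𝒱.embed →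
    (∃ m : ℝ, 𝒱.toCauchyDevelopment.HasCutBondiMass (collarCore M p B Φ) m) →
    ∀ [𝒱.metric.toPseudoRiemannianMetric.HasLeviCivita],
    ∀ (ξ : Π x : 𝒱.carrier, TangentSpace (𝓡 4) x),
    𝒱.metric.IsKillingFieldOn ξ (interior (killingDomain 𝒱 M p B Φ)) →
    (∃ (τ₁ r₁ r₂ : ℝ) (Ψ : (B 0).domain → 𝒱.carrier),
        0 < τ₁ ∧ 2 * M 0 ≤ r₁ ∧ r₁ < r₂ ∧ r₂ ≤ 3 * M 0 ∧
        IsNearModelBox 𝒱.toSpacetime (B 0) k' 0 0 τ₁ r₁ r₂ (interior (killingDomain 𝒱 M p B Φ)) Ψ ∧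
        ∀ x ∈ coordBox (B 0) 0 τ₁ r₁ r₂,
          ξ (Ψ x) = mfderiv 𝓘(ℝ, E4) (𝓡 4) Ψ x (((mo 0).1 : E4 ≃L[ℝ] E4) (E4.basisVector 0))) →
    ∀ ρ : ℝ, ∃ (O : Set (Kerr.region (a 0) (M 0))) (Ψ : (B 0).domain → 𝒱.carrier),
      IsRoofChart (mo 0) (M 0) (a 0) (hpar 0).1 (B 0) (collarCore M p B Φ)
        (interior (killingDomain 𝒱 M p B Φ)) (Φ 0) ρ O Ψ ∧
      ∀ x ∈ pullK (mo 0) (M 0) (a 0) (B 0) (O ∩ interior (JK (M 0) (a 0) (hpar 0).1 (slabK (M 0) (a 0)))),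
        ξ (Ψ x) = mfderiv 𝓘(ℝ, E4) (𝓡 4) Ψ x (((mo 0).1 : E4 ≃L[ℝ] E4) (E4.basisVector 0))

/-! ### F5 — Kerr slab + Kerr roof ⟹ the truncated causal future is Kerr (semi-global uniqueness) -/

/-- **F5 `RoofDevelopmentExtension`** — in a MAXIMAL vacuum Cauchy development with an exact thick
collar (`k' ≥ 1`) on its Cauchy slice and a roof chart for every radius (`IsRoofChart`, no Killing
field involved), there is, for every `ρ, T₀`, an EXACT chart of the collar background on the
pull-back of the truncated open causal future `J⁺_Kerr(slab)° ∩ {t* < T₀, r < ρ}`, with image in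
`J⁺(C)`.  Ingredients: uniqueness for the vacuum Cauchy–CHARACTERISTIC problem with data on the
slab and on the outgoing null hypersurface from its edge (Rendall 1990, Thm. 1 and §5; the
reduction to harmonic gauge); `J⁺_Kerr(slab)° ∩ {r > M} ⊆ D⁺_Kerr(slab ∪ C⁺(S₃))` (past-directed
causal curves from `{r > M}` never reach the inner sheet: `r` increases to the past in
`{r₋ < r < r₊}`); the maximality/gluing argument placing the maximal Cauchy–characteristic
development inside the MGHD (Choquet-Bruhat–Geroch 1969; Sbierski 2016 §3; Hawking–Ellis §7.6).
MISSING in the tree (no characteristic initial value problem is vendored). [cite: Rendall1990, Thm. 1]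
[cite: ChoquetBruhatGeroch1969CMP, Thm. 3] [cite: HawkingEllis1973CUP, §7.6] -/
def RoofDevelopmentExtension : Prop :=
  ∀ [Kerr.Facts] (k' : ℕ), 1 ≤ k' →
    ∀ (X : Type) [TopologicalSpace X] [ChartedSpace E3 X] [IsManifold (𝓡 3) ∞ X]
      [T2Space X] [SecondCountableTopology X] [ConnectedSpace X]
      (D : InitialDataSet (𝓡 3) X) (𝒱 : VacuumCauchyDevelopment D)
      (M a : Fin 1 → ℝ) (p : 𝒱.carrier) (mo : Fin 1 → lorentzGroup × E4)
      (B : Fin 1 → ModelBackground) (Φ : ∀ i, (B i).domain → 𝒱.carrier)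
      (hmax : 𝒱.IsMaximal) (hpar : ∀ i, 0 < M i ∧ |a i| < M i),
    (∃ i, p ∈ Φ i '' (B i).truncTimeSlab (3 * M i) 0) →
    (∀ i, B i = starBackground (mo i).1 (mo i).2 (M i) (a i)
      (fun x => Kerr.radius (a i) (poincareInv (mo i).1 (mo i).2 x))) →
    (∀ i, ContMDiffOn 𝓘(ℝ, E4) (𝓡 4) ∞ (Φ i)
        {x | -1 < (B i).time x.1 ∧ (B i).time x.1 < 1 ∧ (B i).radius x.1 < 3 * M i + 1} ∧
      IsOpenEmbedding ({x | -1 < (B i).time x.1 ∧ (B i).time x.1 < 1 ∧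
        (B i).radius x.1 < 3 * M i + 1}.restrict (Φ i))) →
    (∀ i, 𝒱.toSpacetime.truncDeviationCk (B i) (Φ i) k' (3 * M i) 0 ≤ 0) →
    collarCore M p B Φ ⊆ range 𝒱.embed →
    (∀ ρ : ℝ, ∃ (O : Set (Kerr.region (a 0) (M 0))) (Ψ : (B 0).domain → 𝒱.carrier),
      IsRoofChart (mo 0) (M 0) (a 0) (hpar 0).1 (B 0) (collarCore M p B Φ)
        (𝒱.metric.causalFuture 𝒱.timeOrientation (collarCore M p B Φ)) (Φ 0) ρ O Ψ) →
    ∀ ρ T₀ : ℝ, ∃ Ψ : (B 0).domain → 𝒱.carrier,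
      ContMDiffOn 𝓘(ℝ, E4) (𝓡 4) ∞ Ψ (pullK (mo 0) (M 0) (a 0) (B 0) (truncFutureK (M 0) (a 0) (hpar 0).1 ρ T₀)) ∧
      IsOpenEmbedding ((pullK (mo 0) (M 0) (a 0) (B 0) (truncFutureK (M 0) (a 0) (hpar 0).1 ρ T₀)).restrict Ψ) ∧
      Ψ '' pullK (mo 0) (M 0) (a 0) (B 0) (truncFutureK (M 0) (a 0) (hpar 0).1 ρ T₀) ⊆
        𝒱.metric.causalFuture 𝒱.timeOrientation (collarCore M p B Φ) ∧
      supCkENorm (Subtype.val '' pullK (mo 0) (M 0) (a 0) (B 0) (truncFutureK (M 0) (a 0) (hpar 0).1 ρ T₀)) 0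
        (𝒱.toSpacetime.deviationExtend (B 0) Ψ) ≤ 0

/-! ### F6 — late Kerr-star boxes of every size sit in the open causal future of the slab (pure Kerr) -/

/-- **F6 `KerrLateBoxPlacement`** — in the Kerr star chart `{r > M}`, `0 < M`, `|a| < M`: for all
`R, T` there are `τ, ρ, T₀` with `{τ < t* < τ + T, M < r < R + 1} ⊆ J⁺(slab)° ∩ {t* < T₀, r < ρ}`.
Paper proof: `J⁺(slab) ⊇ {t* > 0, M < r ≤ 3M}` (points with `v = t* + r < 3M` lie in `D⁺(slab)`;
the others are reached by the `∂_{t*}`-orbit of a shell point — timelike for `r > 2M` — followed by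
an ingoing principal null ray `v = const`), and `J⁺(slab) ∩ {r > 3M}` is bounded by the cone
`C⁺(S₃)`, which passes radius `r` at `t* = t_N(r) < ∞` (outgoing null normals of `S₃` have
`ṙ > 0` and reach every radius); take `τ > t_N(R + 1)`, `T₀ = τ + T`, `ρ = R + 1`.  MISSING in the
tree (Kerr causal geometry in the star chart; explicit curves — closable). [cite: DafermosRodnianski2008, §5.1]
[cite: ONeill1995, Ch. 4] -/
def KerrLateBoxPlacement : Prop :=
  ∀ [Kerr.Facts] (M a R T : ℝ) (hM : 0 < M), |a| < M →
    ∃ τ ρ T₀ : ℝ, boxK M a τ (τ + T) M (R + 1) ⊆ truncFutureK M a hM ρ T₀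

/-! ### The glue: K2 ⟸ F4' ∧ F5 ∧ F6 (the Kerr chart facts `[Kerr.Facts]` are discharged in the tree) -/

/-- **K2 follows from F4', F5, F6** (pure bookkeeping: F4' gives the roof charts — moved into
`J⁺(C)` by `killingDomain ⊆ J⁺(C)` —, F5 the exact chart on the truncated causal future, F6 places
the requested box inside it, and an exact chart restricts to an exact box of every order). -/
theorem K2_of_route (h4 : OuterRoofChart) (h5 : RoofDevelopmentExtension)
    (h6 : KerrLateBoxPlacement) : ∀ (k' : ℕ), 2 ≤ k' →
    ∀ (X : Type) [TopologicalSpace X] [ChartedSpace E3 X] [IsManifold (𝓡 3) ∞ X]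
      [T2Space X] [SecondCountableTopology X] [ConnectedSpace X]
      (D : InitialDataSet (𝓡 3) X) (𝒱 : VacuumCauchyDevelopment D)
      (M a : Fin 1 → ℝ) (p : 𝒱.carrier) (mo : Fin 1 → lorentzGroup × E4)
      (B : Fin 1 → ModelBackground) (Φ : ∀ i, (B i).domain → 𝒱.carrier),
    𝒱.IsMaximal → (∀ i, 0 < M i ∧ |a i| < M i) →
    (∃ i, p ∈ Φ i '' (B i).truncTimeSlab (3 * M i) 0) →
    (∀ i, B i = starBackground (mo i).1 (mo i).2 (M i) (a i)
      (fun x => Kerr.radius (a i) (poincareInv (mo i).1 (mo i).2 x))) →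
    (∀ i, ContMDiffOn 𝓘(ℝ, E4) (𝓡 4) ∞ (Φ i)
        {x | -1 < (B i).time x.1 ∧ (B i).time x.1 < 1 ∧ (B i).radius x.1 < 3 * M i + 1} ∧
      IsOpenEmbedding ({x | -1 < (B i).time x.1 ∧ (B i).time x.1 < 1 ∧
        (B i).radius x.1 < 3 * M i + 1}.restrict (Φ i))) →
    (∀ i, 𝒱.toSpacetime.truncDeviationCk (B i) (Φ i) k' (3 * M i) 0 ≤ 0) →
    collarCore M p B Φ ⊆ range 𝒱.embed →
    (∃ m : ℝ, 𝒱.toCauchyDevelopment.HasCutBondiMass (collarCore M p B Φ) m) →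
    ∀ [𝒱.metric.toPseudoRiemannianMetric.HasLeviCivita],
    ∀ (ξ : Π x : 𝒱.carrier, TangentSpace (𝓡 4) x),
    𝒱.metric.IsKillingFieldOn ξ (interior (killingDomain 𝒱 M p B Φ)) →
    (∃ (τ₁ r₁ r₂ : ℝ) (Ψ : (B 0).domain → 𝒱.carrier),
        0 < τ₁ ∧ 2 * M 0 ≤ r₁ ∧ r₁ < r₂ ∧ r₂ ≤ 3 * M 0 ∧
        IsNearModelBox 𝒱.toSpacetime (B 0) k' 0 0 τ₁ r₁ r₂ (interior (killingDomain 𝒱 M p B Φ)) Ψ ∧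
        ∀ x ∈ coordBox (B 0) 0 τ₁ r₁ r₂,
          ξ (Ψ x) = mfderiv 𝓘(ℝ, E4) (𝓡 4) Ψ x (((mo 0).1 : E4 ≃L[ℝ] E4) (E4.basisVector 0))) →
    ∀ (k : ℕ) (R T : ℝ), ∃ (τ : ℝ) (Ψ : (B 0).domain → 𝒱.carrier),
      IsNearModelBox 𝒱.toSpacetime (B 0) k 0 τ (τ + T) (M 0) (R + 1)
        (𝒱.metric.causalFuture 𝒱.timeOrientation (collarCore M p B Φ)) Ψ := by
  haveI : Kerr.Facts :=
    ⟨Kerr.isConnected_region_holds, Kerr.contMDiff_bilin_holds, Kerr.contMDiff_timeVector_holds⟩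
  intro k' hk' X _ _ _ _ _ _ D 𝒱 M a p mo B Φ hmax hpar hp hB hΦ hdev hCX hcut _ ξ hξ hbox k R T
  -- F4': roof charts (image in `interior killingDomain ⊆ J⁺(C)`)
  have hroof := h4 k' hk' X D 𝒱 M a p mo B Φ hmax hpar hp hB hΦ hdev hCX hcut ξ hξ hbox
  have hroof' : ∀ ρ : ℝ, ∃ (O : Set (Kerr.region (a 0) (M 0))) (Ψ : (B 0).domain → 𝒱.carrier),
      IsRoofChart (mo 0) (M 0) (a 0) (hpar 0).1 (B 0) (collarCore M p B Φ)
        (𝒱.metric.causalFuture 𝒱.timeOrientation (collarCore M p B Φ)) (Φ 0) ρ O Ψ := by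
    intro ρ
    obtain ⟨O, Ψ, ⟨hO, hsub, hs, he, hJ, hd, hc, hfr, hS⟩, -⟩ := hroof ρ
    exact ⟨O, Ψ, hO, hsub, hs, he,
      hJ.trans (interior_subset.trans (killingDomain_subset_causalFuture 𝒱 M p B Φ)), hd, hc, hfr, hS⟩
  -- F5: exact chart on the truncated causal future, for every `ρ, T₀`
  have hext := h5 k' (le_trans one_le_two hk') X D 𝒱 M a p mo B Φ hmax hpar hp hB hΦ hdev hCX hroof'
  -- F6: place the box
  obtain ⟨τ, ρ, T₀, hplace⟩ := h6 (M 0) (a 0) R T (hpar 0).1 (hpar 0).2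
  obtain ⟨Ψ, hs, he, hJ, hd⟩ := hext ρ T₀
  refine ⟨τ, Ψ, ?_⟩
  have hsub : coordBox (B 0) τ (τ + T) (M 0) (R + 1) ⊆
      pullK (mo 0) (M 0) (a 0) (B 0) (truncFutureK (M 0) (a 0) (hpar 0).1 ρ T₀) :=
    (coordBox_subset_pullK_boxK (hB 0) τ (τ + T) (M 0) (R + 1)).trans (pullK_mono _ _ _ _ hplace)
  have hopen : IsOpen (coordBox (B 0) τ (τ + T) (M 0) (R + 1)) := by
    rw [hB 0]
    exact isOpen_coordBox (continuous_time_starBackground _ _ _ _ _)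
      (continuous_radius_starBackground _ _ _ _) _ _ _ _
  exact isNearModelBox_of_exactOn hs he hJ hd hsub hopen
    (isOpen_image_val_coordBox_of_eq_starBackground (hB 0) _ _ _ _) k

end K2Route

end Summit.FinalStateConjecture.FinalStateConjecture.Theorems.BondiBartnikRigidity.DirectMethod

end
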